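import Summits.ResolutionOfSingularities.ResolutionOfSingularities.Theorems.FrobeniusClosingPatchingRelPerfectPointBlowupChartAssembly
import HarnessLib

/-!
# Crux `PatchingRelPerfect` (stmt-ResolutionOfSingularities-16161), chain w52 — rung toolkit for
# ITERATED point blow-ups: the Rees chart of a quasi-regular centre carries again a quasi-regular
# centre with regular quotient

[OURS · L1 W5.2 · rung tool] The chartwise assembly (`…PointBlowupChartAssembly.lean`) reduces a
one-blow-up rung to statements on the Rees charts `Spec B_i`, `B_i = (R[It])_{(x_i t)}`, of
`Bl_{(x)} Spec R`.  To ITERATE (chains of infinitely near centres, needed from rung r1g on: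
`I = 𝔪ᵏ + (z)`, `k ≥ 3`) one must feed a chart ring `B_i` back into the assembly as the new base,
which requires, over an ARBITRARY commutative ring `R` with a quasi-regular centre
`x = (x₁, …, x_n)` (no locality):

* `isWeaklyRegular_cons_chartGen`, `isQuasiRegular_cons_chartGen` — on `B_i`, the exceptional
  parameter `x_i` followed by any distinct chart generators `e_j = x_j/x_i` (`j ∈ J`, `j ≠ i`) is
  a weakly regular, hence quasi-regular, sequence (`x_i` is a non-zero-divisor and
  `B_i ⧸ (x_i) ≅ (R/I)[T_j : j ≠ i]`, `chartQuotEquiv`, in which the `e_j` are variables);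
* `isRegularRing_quot_cons_chartGen` — `B_i ⧸ (x_i, e_J) ≅ (R/I)[T_j : j ∉ J, j ≠ i]` is a
  regular ring as soon as `R/I` is (Mathlib: polynomial rings over regular rings are regular);
* `span_range_cons_chartGen` — bookkeeping `(x_i, e_J) = Ideal.ofList …`;
* `isRegular_of_isBlowup_span_singleton_mul_of_forall` — twisting a centre by a principal
  effective Cartier divisor `(g)` does not change the blowing up (Stacks 080B), in the form
  "every blow-up along `J` regular ⇒ every blow-up along `(g)·J` regular";
* `Ideal.map_finsetProd` — `Ideal.map` is multiplicative on finite products;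
* `Ideal.sup_pow_le_pow_sup` — `(P ⊔ Z)ˡ ≤ Pˡ ⊔ Z`.

These are the local-ring-free versions of `isWeaklyRegular_chartFamily` /
`isRegularRing_quot_chartIdeal` of `BlowupChartRsop.lean` (which work in a localisation at a
prime over the closed point of a regular LOCAL base).  Nothing here is a statement of the
manuscript under review.

## References

* The Stacks Project, Tags 0804, 0BIQ, 080B. [StacksProject]
* A. J. de Jong, *Smoothness, semi-stability and alterations*, Publ. Math. IHÉS 83 (1996), 2.4.
  [DeJong1996]
* H. Matsumura, *Commutative Ring Theory*, CUP 1986, Thm. 16.2. [Matsumura1987]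
-/

-- `Summit.<Summit>.<Sub>.Theorems` with `Sub = Summit` (single-conjunct summit, D-0017)
set_option linter.dupNamespace false

noncomputable section

open CategoryTheory CategoryTheory.Limits AlgebraicGeometry Literature.AlgebraicGeometry.Resolution
open scoped Pointwise

namespace Summit.ResolutionOfSingularities.ResolutionOfSingularities.Theorems

universe u

/-! ## Small algebra -/

/-- `Ideal.map` is multiplicative on finite products. [folklore] -/
theorem Ideal.map_finsetProd {R S : Type*} [CommRing R] [CommRing S] (f : R →+* S) {ι : Type*}
    (s : Finset ι) (g : ι → Ideal R) :
    (∏ i ∈ s, g i).map f = ∏ i ∈ s, (g i).map f :=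
  map_prod (Ideal.mapHom f) g s

/-- `(P ⊔ Z)ˡ ≤ Pˡ ⊔ Z` for ideals (every product of `l` factors from `P ⊔ Z` is a product of
factors from `P` plus a multiple of `Z`). [folklore] -/
theorem Ideal.sup_pow_le_pow_sup {R : Type*} [CommSemiring R] (P Z : Ideal R) (l : ℕ) :
    (P ⊔ Z) ^ l ≤ P ^ l ⊔ Z := by
  induction l with
  | zero => simp
  | succ l ih =>
    rw [pow_succ, pow_succ]
    calc (P ⊔ Z) ^ l * (P ⊔ Z) ≤ (P ^ l ⊔ Z) * (P ⊔ Z) := Ideal.mul_mono_left ih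
      _ ≤ P ^ l * P ⊔ Z := by
        rw [Ideal.sup_mul, Ideal.mul_sup, Ideal.mul_sup]
        exact sup_le (sup_le le_sup_left (Ideal.mul_le_left.trans le_sup_right))
          (sup_le (Ideal.mul_le_right.trans le_sup_right) (Ideal.mul_le_right.trans le_sup_right))

/-- **Twisting by a principal effective Cartier divisor** (Stacks 080B, proof): if every blow-up
of `Spec B` along `J~` is regular and `g` is a non-zero-divisor, then every blow-up of `Spec B`
along `((g)·J)~` is regular — it is isomorphic to a blow-up along `J~`
(`IsBlowup.mul_of_isEffectiveCartier` and uniqueness). [cite: StacksProject, Tag 080B (proof)] -/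
theorem isRegular_of_isBlowup_span_singleton_mul_of_forall {B : Type u} [CommRing B] {g : B}
    (hg : g ∈ nonZeroDivisors B) (J : Ideal B)
    (h : ∀ (Y' : Scheme.{u}) (ρ' : Y' ⟶ Spec (.of B)),
      IsBlowup ρ' (affineBlowup.idealSheaf J) → Scheme.IsRegular Y')
    {Y : Scheme.{u}} {ρ : Y ⟶ Spec (.of B)}
    (hρ : IsBlowup ρ (affineBlowup.idealSheaf (Ideal.span {g} * J))) : Scheme.IsRegular Y := by
  obtain ⟨Y', ρ', h'⟩ := exists_isBlowup (Spec (.of B)) (affineBlowup.idealSheaf J)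
  have hreg : Scheme.IsRegular Y' := h Y' ρ' h'
  have h'' : IsBlowup ρ' (affineBlowup.idealSheaf (Ideal.span {g} * J)) := by
    rw [mul_comm, affineBlowup.idealSheaf_mul]
    exact h'.mul_of_isEffectiveCartier (affineBlowup.isEffectiveCartier_idealSheaf_span_singleton hg)
  obtain ⟨e, -, -⟩ := hρ.unique h''
  exact SectionAscent.TraceIdeal.isRegular_of_iso e hreg

/-! ## The Rees chart of a quasi-regular centre over an arbitrary ring -/

section Chart

variable {R : Type u} [CommRing R] {n : ℕ} (c : Fin n → R) (i : Fin n)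
  {a : ℕ} (jJ : Fin a → {j : Fin n // j ≠ i})

local notation3 "I" => Ideal.span (Set.range c)
local notation3 "A" => chartRing c i
local notation3 "ψ" => chartBase c i
local notation3 "u" => chartGen c i
local notation3 "KA" => Ideal.span {chartBase c i (c i)}
local notation3 "P" => MvPolynomial {j : Fin n // j ≠ i} (R ⧸ Ideal.span (Set.range c))

/-- `(x_i, e_J)` as the span of a range and as `Ideal.ofList`. [folklore] -/
theorem span_range_cons_chartGen :
    Ideal.span (Set.range (Fin.cons (ψ (c i)) fun k => u (jJ k).1)) =
      Ideal.ofList (ψ (c i) :: List.ofFn fun k => u (jJ k).1) := by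
  rw [Fin.range_cons, Ideal.span_insert, Ideal.ofList_cons, Ideal.ofList_ofFn]

/-- **`(x_i, e_{j₁}, …, e_{j_a})` is a weakly regular sequence on the chart ring `B_i`** for `c`
quasi-regular and distinct `j_k ≠ i`: `x_i` is a non-zero-divisor of `B_i` (Stacks 0804), and
modulo `x_i` the `e_j` become distinct variables of `(R/I)[T_j : j ≠ i]` (`chartQuotEquiv`),
which form a weakly regular sequence on any polynomial ring. [cite: StacksProject, Tag 0BIQ] -/
theorem isWeaklyRegular_cons_chartGen (hc : IsQuasiRegular c) (hjJ : Function.Injective jJ) :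
    RingTheory.Sequence.IsWeaklyRegular A (ψ (c i) :: List.ofFn fun k => u (jJ k).1) := by
  classical
  have hnzd : ψ (c i) ∈ nonZeroDivisors A :=
    reesChartBase_mem_nonZeroDivisors (c i) (Ideal.mem_span_range_self (f := c) (x := i))
  rw [RingTheory.Sequence.isWeaklyRegular_cons_iff]
  constructor
  · exact Module.Flat.isSMulRegular_of_nonZeroDivisors hnzd
  · -- the variables `T_{jJ k}` are weakly regular on `P`
    have hP : RingTheory.Sequence.IsWeaklyRegular P
        (List.ofFn fun k => (MvPolynomial.X (jJ k) : P)) := by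
      have := MvPolynomial.isWeaklyRegular_map_X (R := R ⧸ I) (List.ofFn jJ)
        (List.nodup_ofFn.mpr hjJ)
      rwa [List.map_ofFn] at this
    -- transport along `ε : P ≃ A ⧸ (x_i)`
    let ε : P ≃+* A ⧸ KA := chartQuotEquiv c i hc
    have hAK : RingTheory.Sequence.IsWeaklyRegular (A ⧸ KA)
        (List.ofFn fun k => Ideal.Quotient.mk KA (u (jJ k).1)) := by
      have h1 := (RingEquiv.isWeaklyRegular_map_iff ε
        (List.ofFn fun k => (MvPolynomial.X (jJ k) : P))).mpr hP
      rw [List.map_ofFn] at h1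
      have h2 : (⇑ε ∘ fun k => (MvPolynomial.X (jJ k) : P)) =
          fun k => Ideal.Quotient.mk KA (u (jJ k).1) := by
        funext k
        simp only [Function.comp_apply]
        exact chartQuotMap_X c i (jJ k)
      rwa [h2] at h1
    -- as an `A`-module
    have hAK' : RingTheory.Sequence.IsWeaklyRegular (A ⧸ KA)
        (List.ofFn fun k => u (jJ k).1) := by
      rw [← RingTheory.Sequence.isWeaklyRegular_map_algebraMap_iff (A ⧸ KA), List.map_ofFn]
      exact hAK
    -- `QuotSMulTop (x_i) A ≃ₗ[A] A ⧸ (x_i)`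
    have hK : (ψ (c i) • ⊤ : Submodule A A) = KA := by
      rw [← Submodule.ideal_span_singleton_smul, smul_eq_mul, Ideal.mul_top]
    let eq : QuotSMulTop (ψ (c i)) A ≃ₗ[A] A ⧸ KA := Submodule.quotEquivOfEq _ _ hK
    exact (eq.isWeaklyRegular_congr _).mpr hAK'

/-- Hence **`(x_i, e_J)` is a quasi-regular sequence on `B_i`** (Rees). [cite: Matsumura1987, Thm. 16.2] -/
theorem isQuasiRegular_cons_chartGen (hc : IsQuasiRegular c) (hjJ : Function.Injective jJ) :
    IsQuasiRegular (Fin.cons (ψ (c i)) fun k => u (jJ k).1 : Fin (a + 1) → A) := by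
  refine isQuasiRegular_of_isWeaklyRegular _ ?_
  have h := isWeaklyRegular_cons_chartGen c i jJ hc hjJ
  have hl : List.ofFn (Fin.cons (ψ (c i)) fun k => u (jJ k).1 : Fin (a + 1) → A) =
      ψ (c i) :: List.ofFn fun k => u (jJ k).1 := by
    rw [List.ofFn_succ]
    simp only [Fin.cons_zero, Fin.cons_succ]
  rw [hl]
  exact h

/-- **`B_i ⧸ (x_i, e_J) ≅ (R/I)[T_j : j ∉ J, j ≠ i]` is a regular ring when `R/I` is** (de Jong's
chart computation without the residue-field step; Mathlib: polynomial rings over regular rings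
are regular). [cite: StacksProject, Tag 0BIQ] [cite: DeJong1996, 2.4] -/
theorem isRegularRing_quot_cons_chartGen (hc : IsQuasiRegular c)
    [IsRegularRing (R ⧸ Ideal.span (Set.range c))] :
    IsRegularRing (A ⧸ Ideal.span (Set.range (Fin.cons (ψ (c i)) fun k => u (jJ k).1))) := by
  classical
  let ε : P ≃+* A ⧸ KA := chartQuotEquiv c i hc
  set sJ : Set {j : Fin n // j ≠ i} := Set.range jJ with hsJ
  set K₁ : Ideal P := Ideal.ofList (List.ofFn fun k => (MvPolynomial.X (jJ k) : P)) with hK₁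
  have hK₁eq : K₁ = Ideal.span (MvPolynomial.X '' sJ : Set P) := by
    rw [hK₁, Ideal.ofList_ofFn, hsJ, ← Set.range_comp]
    rfl
  -- `P ⧸ K₁ ≅ (R/I)[T_j : j ∉ sJ]`, a regular ring
  have e4 : (P ⧸ K₁) ≃+* MvPolynomial {j : {j : Fin n // j ≠ i} // j ∉ sJ} (R ⧸ I) :=
    (Ideal.quotEquivOfEq hK₁eq).trans (MvPolynomial.quotientSpanXEquiv sJ).toRingEquiv
  -- the ideal `(x_i, e_J)` modulo `(x_i)` is `ε(K₁)`
  set K₀ : Ideal A := Ideal.span (Set.range (Fin.cons (ψ (c i)) fun k => u (jJ k).1)) with hK₀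
  have hK₀' : K₀ = Ideal.ofList (ψ (c i) :: List.ofFn fun k => u (jJ k).1) :=
    span_range_cons_chartGen c i jJ
  have hK₀map : K₀.map (Ideal.Quotient.mk KA) = K₁.map (ε : P →+* A ⧸ KA) := by
    have h0 : Ideal.span {Ideal.Quotient.mk KA (ψ (c i))} = ⊥ :=
      Ideal.span_singleton_eq_bot.mpr (Ideal.Quotient.eq_zero_iff_mem.mpr
        (Ideal.subset_span rfl))
    rw [hK₀', Ideal.map_ofList, List.map_cons, Ideal.ofList_cons, h0, bot_sup_eq, hK₁,
      Ideal.map_ofList, List.map_ofFn, List.map_ofFn]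
    have h1 : (⇑(Ideal.Quotient.mk KA) ∘ fun k => u (jJ k).1) =
        (⇑(ε : P →+* A ⧸ KA) ∘ fun k => (MvPolynomial.X (jJ k) : P)) :=
      funext fun k => by
        simp only [Function.comp_apply, RingHom.coe_coe]
        exact (chartQuotMap_X c i (jJ k)).symm
    rw [h1]
  have e2 : (A ⧸ KA) ⧸ K₀.map (Ideal.Quotient.mk KA) ≃+* P ⧸ K₁ :=
    (Ideal.quotientEquiv K₁ _ ε hK₀map).symm
  have hle : KA ≤ K₀ := by
    rw [hK₀', Ideal.ofList_cons]
    exact le_sup_left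
  have e1 := (DoubleQuot.quotQuotEquivQuotOfLE hle).symm
  exact IsRegularRing.of_ringEquiv (e4.symm.trans (e2.symm.trans e1.symm))

end Chart

end Summit.ResolutionOfSingularities.ResolutionOfSingularities.Theorems

end
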